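import Summits.ResolutionOfSingularities.ResolutionOfSingularities.Theorems.HilbertSamuelEliminationSigmaMaxModificationsCorridor3SigmaSurfaceBadnessPointCureNext
import Summits.ResolutionOfSingularities.ResolutionOfSingularities.Theorems.HilbertSamuelEliminationSigmaMaxModificationsCorridor3SigmaMenuSurfaceCureStep
import Summits.ResolutionOfSingularities.ResolutionOfSingularities.Theorems.HilbertSamuelEliminationSigmaMaxModificationsCorridor3SigmaSncCarrierOfSnc
import Summits.ResolutionOfSingularities.ResolutionOfSingularities.Theorems.HilbertSamuelEliminationSigmaMaxModificationsCorridor3SigmaSurfaceTraceSetNowhereDense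
import Literature.AlgebraicGeometry.Resolution.RegularCentreRsopGenerated
import Literature.AlgebraicGeometry.Resolution.MonomialMarkedIdeals
import Literature.AlgebraicGeometry.Resolution.AlterationsNormalFormStrictTransform
import HarnessLib

/-!
# [OURS · L1 W4.2] σ-LAYER PHASE B′ — `Corridor3SigmaMenuSurfaceCureStepLaws`: THE LAWS OF res-L1-type-o1's CURE SUB-ORACLE `cureStepOfRecord` (p564099) — the two
# obligations left open BY NAME for this seat are DISCHARGED (`BadComponentsRegular`: components of an snc configuration of a regular surface are regular curves; `hXcl`:
# counted crossing points are closed), the cure SPEAKS IFF `0 < M` (Noetherian surface), and AT EVERY PROPOSAL `lex(ℓ, M)` DROPS: `ℓ` stays `0` and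
# `M(E.next C, D_next) < M(E, D)`; CAPSTONE: on a regular surface with snc configuration every step of o1's `SurfacePrep.ofRecord regular phaseS badGatedOfRecord
# cureStepOfRecord pointStepOfRecord` makes `(ℓ, M)` lexicographically smaller
# (RULING v3.14-43 (KN) (R-a); res-L1-w42-stub-1 DESIGN CHECK 2 (c); o1 p564099 «Open BY NAME for stub-1/067: `BadComponentsRegular`, `hXcl`»; crux chain w42
# `SigmaMaxModifications` stmt-ResolutionOfSingularities-18506 / conjunct `SigmaMaxModificationsCorridor3` stmt-ResolutionOfSingularities-19249; helper of res-L1-w42-stub-1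
# (gen 6), `--supports stmt-…-19249 --as helper`, counted 0)

HONEST FRAMING. OURS bookkeeping over o1's `…MenuSurfaceCureStep` (definitions of record: `surfaceTraces`, `IsBadComponent`, `componentCentre`, `cureStepOfRecord`,
`BadComponentsRegular`), this seat's M-lane (`…CureNext`, `…PointCureNext`, `…SurfaceBadnessZero`), ℓ-lane (p550218, p555284, p548141), and Literature
`isRsopGeneratedAt_of_isRsopPart_span_eq` / `isRegular_subscheme_of_isRsopGeneratedAt` (Matsumura 14.2), `isRegular_subscheme_vanishingIdeal_range`. The M-drop carries the
coincidence HYPOTHESIS `E.Coincides C` and «members locally principal» (run invariants of o1/060, `…BoundaryCoincidenceHolds` p561751). NOTHING here is a statement of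
H. Hironaka's manuscript [Hironaka2017] nor of [CossartJannsenSaito2020]; no named fact. AI-written; AI review is weaker than expert review.

## Contents (namespace `…Theorems.SigmaMaxModificationsCorridor3.Sigma`)

* `hXcl` DISCHARGED: `isClosed_singleton_of_mem_crossingPts`, **`isClosed_singleton_subschemeι_of_mem_crossingPts`** (dimension `≤ 2`).
* `BadComponentsRegular` DISCHARGED: `isRegular_subscheme_primeDivisorIdeal_of_codimOne`, **`isRegular_subscheme_componentCentre`** (regular `D̃`, snc configuration),
  **`badComponentsRegular_of_snc`** (for any `regular`/`bad` readings such that firing implies `D̃` regular with snc configuration — e.g. the ℓ-gated `badGatedOfRecord` under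
  F-75c).
* **`exists_cureStepOfRecord_iff_badOfRecord_pos`** (Noetherian `D̃` of dimension `≤ 2`, irreducible `D`).
* **`badOfRecord_next_lt_of_cureStepOfRecord`**, `surfaceSncLength_next_eq_zero_of_cureStepOfRecord`, CAPSTONE **`lex_surfaceSncLength_badOfRecord_next_lt_of_ofRecord`**
  (+ `_of_stacks0BIC`: the ℓ-gate read through F-75c, p556167).
* (rev 2) `badComponentsRegular_badGatedOfRecord_of_stacks0BIC` / `cureStepOfRecord_regular_subset_of_stacks0BIC` (o1's `hreg`/`hcure` for the readings of record
  behind the ℓ-gate, via F-75c) and the (PROGRESS)-shaped `toLex_…` forms of the capstone (rank in `ℕ ×ₗ ℕ`, `…SigmaMenuTiersWF`).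

VACUITY SELF-CHECK. `cureStepOfRecord` is o1's definition; the laws' hypotheses (irreducible `D`, Noetherian regular `D̃` of dimension `≤ 2`, `S(E, D)` snc, members locally
principal, coincidence) are those of the B′ cure branch; DESIGN CHECK 1's witness runs `M: 2 ↦ 1 ↦ 0` through branch (b) then (a).
-/

noncomputable section

set_option linter.dupNamespace false -- mandated namespace of this single-conjunct summit

open CategoryTheory AlgebraicGeometry TopologicalSpace IsLocalRing
open Summit.ResolutionOfSingularities.ResolutionOfSingularities.Theorems.CampaignW42
open Literature.AlgebraicGeometry.Resolution Literature.RingTheory.HilbertSamuel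

namespace Summit.ResolutionOfSingularities.ResolutionOfSingularities.Theorems.SigmaMaxModificationsCorridor3.Sigma

universe u

open Scheme.IdealSheafData

variable {W : Scheme.{u}}

/-! ## `hXcl`: counted crossing points are closed -/

/-- **A counted crossing point is a closed point** of a scheme all of whose points have codimension `≤ 2` (it has codimension two, the maximum). [folklore] -/
theorem isClosed_singleton_of_mem_crossingPts {DS : Scheme.{u}} (h2 : ∀ y : DS, Order.coheight y ≤ 2) {Γs : Boundary DS} {Γ : DS.IdealSheafData} {x : DS}
    (hx : x ∈ Γs.crossingPts Γ) : IsClosed ({x} : Set DS) := by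
  have hx2 : Order.coheight x = 2 := coheight_eq_two_of_mem_crossingPts h2 hx
  rw [← closure_eq_iff_isClosed]
  refine Set.Subset.antisymm (fun y hy => ?_) subset_closure
  rw [← specializes_iff_mem_closure] at hy
  have hfin : Order.coheight y ≠ ⊤ := ne_top_of_le_ne_top (by decide) (h2 y)
  exact Set.mem_singleton_iff.mpr (eq_of_specializes_of_coheight_le hy hfin (by rw [hx2]; exact h2 y)).symm

/-- **`hXcl` DISCHARGED**: on a surface `D` whose reduced surface has dimension `≤ 2`, every counted crossing point of a filtered trace is closed in `W`. [folklore] -/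
theorem isClosed_singleton_subschemeι_of_mem_crossingPts {E : Boundary W} {D : Closeds W} (hdim : topologicalKrullDim ↥(menuCentre D).subscheme ≤ 2) :
    ∀ Γ ∈ surfaceTraces E D, ∀ x ∈ (surfaceTraces E D).crossingPts Γ, IsClosed ({(menuCentre D).subschemeι x} : Set W) :=
  fun _ _ _ hx => isClosed_singleton_subschemeι D (isClosed_singleton_of_mem_crossingPts (coheight_le_two_of_topologicalKrullDim_le hdim) hx)

/-! ## `BadComponentsRegular`: components of an snc configuration of a regular surface are regular curves -/

/-- **A COMPONENT OF AN SNC CONFIGURATION IS A REGULAR CURVE**: on a locally Noetherian integral scheme, for `S` a strict normal crossings divisor missing the generic point and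
`ζ ∈ S` of codimension one, the reduced subscheme on `cl{ζ}` is regular (at each of its points `𝓟_ζ` is generated by ONE of the snc parameters; Matsumura 14.2). [folklore] -/
theorem isRegular_subscheme_primeDivisorIdeal_of_codimOne {DS : Scheme.{u}} [IsLocallyNoetherian DS] [IsIntegral DS] {S : Set DS}
    (hS : IsStrictNormalCrossingsDivisor DS S) (hgen : genericPoint DS ∉ S) {ζ : DS} (hζS : ζ ∈ S) (hζ : Order.coheight ζ = 1) :
    Scheme.IsRegular (primeDivisorIdeal ζ).subscheme := by
  have hSc : IsClosed S := hS.isClosed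
  have hcl : (⟨closure S, isClosed_closure⟩ : Closeds DS) = ⟨S, hSc⟩ := Closeds.ext hSc.closure_eq
  refine isRegular_subscheme_of_isRsopGeneratedAt fun y hy => ?_
  have hsp : ζ ⤳ y := (mem_support_primeDivisorIdeal_iff ζ y).mp hy
  have hyS : y ∈ S := hSc.closure_subset_iff.mpr (Set.singleton_subset_iff.mpr hζS) hsp.mem_closure
  obtain ⟨r, z, -, hz, hI⟩ := (isSNCIdeal_iff_exists_isRsopPart _).mp (hS.isStrictNormalCrossingsAt hyS)
  rw [hcl] at hI
  obtain ⟨i, hi⟩ := stalkIdeal_primeDivisorIdeal_eq_span_of_mem_maxPoints hSc (mem_maxPoints_of_coheight_eq_one hgen hζS hζ) hsp hz hI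
  refine isRsopGeneratedAt_of_isRsopPart_span_eq (c := fun _ : Fin 1 => z i) (hz.comp (fun _ => i) fun a b _ => Subsingleton.elim a b) ?_
  rw [hi]
  congr 1
  ext a
  simp

/-- **THE REDUCED CURVE `componentCentre D ζ` OF A COMPONENT OF THE SNC CONFIGURATION IS REGULAR** (irreducible `D`, `S(E, D)` snc on `D̃` — which makes `D̃` regular along
`S(E, D)` —, `ζ` a codimension-one point of `S(E, D)`): it is the image under the closed immersion `ι_D` of the regular reduced curve `V(𝓟_ζ) ⊆ D̃`. [folklore] -/
theorem isRegular_subscheme_componentCentre [IsLocallyNoetherian W] {E : Boundary W} {D : Closeds W} (hDirr : IsIrreducible (D : Set W))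
    (hS : IsStrictNormalCrossingsDivisor (menuCentre D).subscheme (surfaceTraceSet E D))
    {ζ : ↥(menuCentre D).subscheme} (hζ : ζ ∈ (surfaceTraces E D).codimOnePoints) : Scheme.IsRegular (componentCentre D ζ).subscheme := by
  set ι := (menuCentre D).subschemeι with hι
  haveI : IsIntegral (menuCentre D).subscheme := isIntegral_subscheme_vanishingIdeal D hDirr
  haveI : IsLocallyNoetherian (menuCentre D).subscheme := LocallyOfFiniteType.isLocallyNoetherian ι
  have hgen : genericPoint ↥(menuCentre D).subscheme ∉ surfaceTraceSet E D := fun hg => by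
    obtain ⟨Γ', hΓ', hg'⟩ := Boundary.mem_divisorSet_iff.mp hg
    exact not_mem_support_genericPoint (ne_bot_of_mem_restrictOff (E := E) Γ' hΓ') hg'
  have hregP := isRegular_subscheme_primeDivisorIdeal_of_codimOne hS hgen hζ.1 hζ.2
  set f := (primeDivisorIdeal ζ).subschemeι ≫ ι with hf
  have hrange : Set.range f.base = closure {ι.base ζ} := by
    rw [hf, Scheme.Hom.comp_base, TopCat.coe_comp, Set.range_comp]
    have h1 : Set.range ((primeDivisorIdeal ζ).subschemeι).base = closure {ζ} := by
      have := Scheme.IdealSheafData.range_subschemeι (primeDivisorIdeal ζ)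
      rw [coe_support_primeDivisorIdeal] at this
      exact this
    rw [h1, ← ι.isClosedEmbedding.closure_image_eq, Set.image_singleton]
  have hZ : (⟨Set.range f.base, f.isClosedEmbedding.isClosed_range⟩ : Closeds W) = ⟨closure {ι.base ζ}, isClosed_closure⟩ := Closeds.ext hrange
  have h := isRegular_subscheme_vanishingIdeal_range f hregP
  rw [hZ] at h
  exact h

/-- **`BadComponentsRegular` DISCHARGED for every regularity/badness reading whose firing implies «the configuration `S(E, D)` is snc on `D̃`»** (e.g. `bad := badGatedOfRecord`
under F-75c on regular excellent surfaces, where `0 < bad'` forces `ℓ = 0`, i.e. `S(E, D)` snc). [folklore] -/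
theorem badComponentsRegular_of_snc {N : ℕ} {ν : ℕ → ℕ} (regular : SurfaceRegularity.{u}) (bad : SurfaceBadness.{u})
    (hfire : ∀ (W : Scheme.{u}) (_ : IsLocallyNoetherian W) (E : Boundary W) (D : Closeds W), (D : Set W) ∈ surfaceComponents W N ν → regular W D → 0 < bad W E D →
      IsStrictNormalCrossingsDivisor (menuCentre D).subscheme (surfaceTraceSet E D)) :
    BadComponentsRegular regular bad N ν := by
  intro W hW E D hD hr hM ζ hζ
  haveI := hW
  exact isRegular_subscheme_componentCentre (componentsIn.isIrreducible hD.1) (hfire W hW E D hD hr hM) hζ.1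

/-! ## When does the cure speak? -/

/-- **THE CURE SPEAKS IFF `0 < M(E, D)`** (irreducible `D`, Noetherian `D̃` of dimension `≤ 2`; o1's two directions with this seat's finiteness / non-zero-stalk / `hXcl`
premises discharged). [folklore] -/
theorem exists_cureStepOfRecord_iff_badOfRecord_pos {hW : IsLocallyNoetherian W} {N : ℕ} {ν : ℕ → ℕ} {L : Labelling W} {P : Option (Pending W)} {E : Boundary W}
    {D : Closeds W} [AlgebraicGeometry.IsNoetherian (menuCentre D).subscheme] (hDirr : IsIrreducible (D : Set W)) (hdim : topologicalKrullDim ↥(menuCentre D).subscheme ≤ 2) :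
    (∃ C : W.IdealSheafData, cureStepOfRecord W hW N ν L P E D C) ↔ 0 < badOfRecord W E D := by
  haveI : IsIntegral (menuCentre D).subscheme := isIntegral_subscheme_vanishingIdeal D hDirr
  have hne := ne_bot_of_mem_restrictOff (E := E) (ι := (menuCentre D).subschemeι)
  have h2 := coheight_le_two_of_topologicalKrullDim_le hdim
  have hfinT : (surfaceTraces E D).codimOnePoints.Finite := Boundary.codimOnePoints_finite hne
  have hfinX : ∀ Γ ∈ surfaceTraces E D, ((surfaceTraces E D).crossingPts Γ).Finite := fun Γ hΓ => Boundary.crossingPts_finite_of_coheight_le_two h2 (hne Γ hΓ)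
  have hnz : ∀ Γ ∈ surfaceTraces E D, ∀ y, stalkIdeal Γ y ≠ ⊥ := fun Γ hΓ y => stalkIdeal_ne_bot_of_ne_bot (hne Γ hΓ) y
  constructor
  · rintro ⟨C, hC⟩
    rw [badOfRecord_eq_badness_surfaceTraces, pos_iff_ne_zero]
    exact fun h0 => not_cureStepOfRecord_of_badness_eq_zero hfinT hfinX hnz h0 hC
  · exact exists_cureStepOfRecord_of_badOfRecord_pos hfinT hfinX hnz (isClosed_singleton_subschemeι_of_mem_crossingPts hdim)

/-! ## `lex(ℓ, M)` drops at every proposal of the cure -/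

section Lex

variable {hW : IsLocallyNoetherian W} {N : ℕ} {ν : ℕ → ℕ} {L : Labelling W} {P : Option (Pending W)} {E : Boundary W} {D : Closeds W}
  {C : W.IdealSheafData}

/-- `componentCentre D ζ` in the shape used by `…CureNext` (image of the closure = closure of the image along the closed immersion). [folklore] -/
theorem componentCentre_eq (D : Closeds W) (ζ : ↥(menuCentre D).subscheme) :
    componentCentre D ζ = vanishingIdeal ⟨(menuCentre D).subschemeι.base '' closure {ζ},
      (menuCentre D).subschemeι.isClosedEmbedding.isClosedMap _ isClosed_closure⟩ := by
  have hset : closure {(menuCentre D).subschemeι.base ζ} = (menuCentre D).subschemeι.base '' closure {ζ} := by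
    rw [← (menuCentre D).subschemeι.isClosedEmbedding.closure_image_eq, Set.image_singleton]
  unfold componentCentre
  exact congrArg vanishingIdeal (Closeds.ext hset)

/-- **`M` STRICTLY DROPS AT EVERY CURE STEP OF THE RUN** (irreducible `D`; Noetherian regular `D̃` of dimension `≤ 2`; `S(E, D)` snc — the ℓ-gate; members locally principal;
coincidence). [folklore] -/
theorem badOfRecord_next_lt_of_cureStepOfRecord [AlgebraicGeometry.IsNoetherian (menuCentre D).subscheme] (hstep : cureStepOfRecord W hW N ν L P E D C)
    (hDirr : IsIrreducible (D : Set W)) (hreg : Scheme.IsRegular (menuCentre D).subscheme) (hdim : topologicalKrullDim ↥(menuCentre D).subscheme ≤ 2)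
    (hS : IsStrictNormalCrossingsDivisor (menuCentre D).subscheme (surfaceTraceSet E D)) (hE : ∀ B ∈ E, IsLocallyPrincipal B) (hcoin : E.Coincides C) :
    badOfRecord (blowup C) (E.next C) (surfaceNext (blowup.π C) C D) < badOfRecord W E D := by
  haveI := hW
  rcases hstep with ⟨ζ, ⟨hζ, hbad⟩, hC⟩ | ⟨-, Γ, hΓ, x, hx, hxc, hC⟩
  · rw [componentCentre_eq] at hC
    exact badOfRecord_next_lt_of_cure hDirr hreg hdim hS hcoin hζ hbad hC
  · exact badOfRecord_next_lt_of_pointCure hDirr hreg hdim hS hE hcoin hΓ hx hxc hC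

/-- **`ℓ` STAYS `0` AT EVERY CURE STEP OF THE RUN** (the curve step is an isomorphism of the surface, p550218; the point step blows up a point of an snc configuration,
p555284). [folklore] -/
theorem surfaceSncLength_next_eq_zero_of_cureStepOfRecord [AlgebraicGeometry.IsNoetherian (menuCentre D).subscheme] (hstep : cureStepOfRecord W hW N ν L P E D C)
    (hDirr : IsIrreducible (D : Set W)) (hreg : Scheme.IsRegular (menuCentre D).subscheme) (hdim : topologicalKrullDim ↥(menuCentre D).subscheme ≤ 2)
    (hS : IsStrictNormalCrossingsDivisor (menuCentre D).subscheme (surfaceTraceSet E D)) :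
    surfaceSncLength (E.next C) (surfaceNext (blowup.π C) C D) = 0 := by
  haveI := hW
  haveI : IsIntegral (menuCentre D).subscheme := isIntegral_subscheme_vanishingIdeal D hDirr
  have hℓ : surfaceSncLength E D = 0 := by
    apply Nat.le_zero.mp
    apply minLength_le
    rw [ExistsPointCompositionN.zero_iff, resolvesToSnc_iff]
    exact hS
  rcases hstep with ⟨ζ, ⟨hζ, -⟩, hC⟩ | ⟨-, Γ, hΓ, x, hxc, hx, hC⟩
  · rw [componentCentre_eq] at hC
    rw [surfaceSncLength_next_eq_of_primeDivisor hDirr hreg hζ.2 hC ?_, hℓ]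
    obtain ⟨Γ, hΓ, hζΓ⟩ := Boundary.mem_divisorSet_iff.mp hζ.1
    exact (Γ.support.isClosed.closure_subset_iff.mpr (Set.singleton_subset_iff.mpr hζΓ)).trans fun y hy => Boundary.mem_divisorSet_iff.mpr ⟨Γ, hΓ, hy⟩
  · have h2 := coheight_le_two_of_topologicalKrullDim_le hdim
    have hx2 : Order.coheight x = 2 := coheight_eq_two_of_mem_crossingPts h2 hxc
    have hxcl : IsClosed ({x} : Set ↥(menuCentre D).subscheme) := isClosed_singleton_of_mem_crossingPts h2 hxc
    have hne : ({x} : Set ↥(menuCentre D).subscheme) ≠ Set.univ := by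
      intro h
      have : genericPoint ↥(menuCentre D).subscheme ∈ ({x} : Set _) := h ▸ Set.mem_univ _
      exact genericPoint_ne_of_coheight_eq_two hx2 this
    have hxS : x ∈ surfaceTraceSet E D := by
      obtain ⟨⟨ζ₁, h₁, -, -, -, hs₁, -⟩, -⟩ := hxc
      exact Boundary.mem_divisorSet_iff.mpr ⟨Γ, hΓ, Γ.support.isClosed.closure_subset_iff.mpr (Set.singleton_subset_iff.mpr h₁.1) hs₁.mem_closure⟩
    exact (surfaceSncLength_next_eq_zero_of_point hreg hDirr hS hxcl hx hne hxS hC).2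

/-- **CAPSTONE: `lex(ℓ, M)` STRICTLY DROPS AT EVERY STEP OF `SurfacePrep.ofRecord regular phaseS badGatedOfRecord cureStepOfRecord pointStepOfRecord` ON A REGULAR SURFACE
WITH SNC-OR-NOT CONFIGURATION** — for ANY readings `regular`, `phaseS`: if `regular W D` holds, `D̃` is regular and the oracle proposes `C` for the irreducible surface `D`
(Noetherian `D̃` of dimension `≤ 2`, members locally principal, coincidence; and, when the cure fires, `S(E, D)` snc — the ℓ-gate `0 < bad'` gives `ℓ = 0`, read as snc by
`hgate`, e.g. F-75c's `surfaceSncLength_pos_iff'`), then `(ℓ, M)` of the next state is lexicographically smaller. PHASE B′ of (P1*) terminates. [folklore] -/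
theorem lex_surfaceSncLength_badOfRecord_next_lt_of_ofRecord [AlgebraicGeometry.IsNoetherian (menuCentre D).subscheme] {regular : SurfaceRegularity.{u}}
    {phaseS : SurfacePrep.{u}} (h : SurfacePrep.ofRecord regular phaseS badGatedOfRecord cureStepOfRecord pointStepOfRecord W hW N ν L P E D C) (hr : regular W D)
    (hDirr : IsIrreducible (D : Set W)) (hreg : Scheme.IsRegular (menuCentre D).subscheme) (hdim : topologicalKrullDim ↥(menuCentre D).subscheme ≤ 2)
    (hgate : surfaceSncLength E D = 0 → IsStrictNormalCrossingsDivisor (menuCentre D).subscheme (surfaceTraceSet E D)) (hE : ∀ B ∈ E, IsLocallyPrincipal B)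
    (hcoin : E.Coincides C) :
    Prod.Lex (· < ·) (· < ·)
      (surfaceSncLength (E.next C) (surfaceNext (blowup.π C) C D), badOfRecord (blowup C) (E.next C) (surfaceNext (blowup.π C) C D))
      (surfaceSncLength E D, badOfRecord W E D) := by
  haveI := hW
  rcases (SurfacePrep.ofRecord_iff).mp h with ⟨hnr, -⟩ | ⟨-, hpos, hc⟩ | ⟨-, -, hp⟩
  · exact absurd hr hnr
  · obtain ⟨hℓ, -⟩ := (badGatedOfRecord_pos_iff E D).mp hpos
    have hS := hgate hℓ
    rw [hℓ, surfaceSncLength_next_eq_zero_of_cureStepOfRecord hc hDirr hreg hdim hS]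
    exact Prod.Lex.right _ (badOfRecord_next_lt_of_cureStepOfRecord hc hDirr hreg hdim hS hE hcoin)
  · exact Prod.Lex.left _ _ (surfaceSncLength_next_lt_of_pointStepOfRecord hp hDirr)

/-- **THE CAPSTONE WITH THE ℓ-GATE READ THROUGH F-75c** (`Stacks0BIC_embeddedResolutionCurvesInSurfaces_locus`, p556167 `surfaceSncLength_pos_iff'`: on an irreducible surface
with Noetherian regular excellent two-dimensional `D̃`, `ℓ = 0 ↔ S(E, D)` snc): every step of o1's (P1*) prep oracle of record on such a surface makes `(ℓ, M)` lexicographically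
smaller. [folklore] -/
theorem lex_surfaceSncLength_badOfRecord_next_lt_of_ofRecord_of_stacks0BIC (hF : Stacks0BIC_embeddedResolutionCurvesInSurfaces_locus.{u})
    [AlgebraicGeometry.IsNoetherian (menuCentre D).subscheme] {regular : SurfaceRegularity.{u}} {phaseS : SurfacePrep.{u}}
    (h : SurfacePrep.ofRecord regular phaseS badGatedOfRecord cureStepOfRecord pointStepOfRecord W hW N ν L P E D C) (hr : regular W D)
    (hDirr : IsIrreducible (D : Set W)) (hreg : Scheme.IsRegular (menuCentre D).subscheme) (hexc : Scheme.IsExcellent (menuCentre D).subscheme)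
    (hdim : topologicalKrullDim ↥(menuCentre D).subscheme = 2) (hE : ∀ B ∈ E, IsLocallyPrincipal B) (hcoin : E.Coincides C) :
    Prod.Lex (· < ·) (· < ·)
      (surfaceSncLength (E.next C) (surfaceNext (blowup.π C) C D), badOfRecord (blowup C) (E.next C) (surfaceNext (blowup.π C) C D))
      (surfaceSncLength E D, badOfRecord W E D) := by
  refine lex_surfaceSncLength_badOfRecord_next_lt_of_ofRecord h hr hDirr hreg hdim.le (fun hℓ => ?_) hE hcoin
  by_contra hns
  have := (surfaceSncLength_pos_iff' hF E D hDirr hreg hexc hdim).mpr hns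
  omega

end Lex

section GatedRecord

variable {hW : IsLocallyNoetherian W} {N : ℕ} {ν : ℕ → ℕ} {L : Labelling W} {P : Option (Pending W)} {E : Boundary W} {D : Closeds W}
  {C : W.IdealSheafData}

/-- A surface component of `X(ν)` carries a two-dimensional reduced subscheme (`surfaceComponents` asks `dim D = 2`; the reduced structure is homeomorphic to `D`).
[folklore] -/
theorem topologicalKrullDim_menuCentre_subscheme_of_mem_surfaceComponents (hD : (D : Set W) ∈ surfaceComponents W N ν) :
    topologicalKrullDim ↥(menuCentre D).subscheme = 2 := by
  rw [topologicalKrullDim_subscheme_vanishingIdeal]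
  exact hD.2

/-- **`BadComponentsRegular` FOR THE ℓ-GATED COUNT OF RECORD `badGatedOfRecord`, READ THROUGH F-75c** (`Stacks0BIC_embeddedResolutionCurvesInSurfaces_locus`): for ANY
regularity reading `regular` at least as strong as «`D̃` Noetherian, regular and excellent» on the surface components of `X(ν)`, the bad components at every state where
the gated cure fires (`0 < badGatedOfRecord W E D`, i.e. `ℓ = 0 < M`) have regular centres — `ℓ = 0` reads `S(E, D)` snc (`surfaceSncLength_pos_iff'`, p556167) on the
two-dimensional (`surfaceComponents`) irreducible (`componentsIn`) surface, and `isRegular_subscheme_componentCentre` concludes. This is o1's `hreg` input of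
`cureStepOfRecord_regular_subset` for the readings of record. [folklore] -/
theorem badComponentsRegular_badGatedOfRecord_of_stacks0BIC (hF : Stacks0BIC_embeddedResolutionCurvesInSurfaces_locus.{u}) (regular : SurfaceRegularity.{u})
    (hregular : ∀ (W : Scheme.{u}) (_ : IsLocallyNoetherian W) (D : Closeds W), (D : Set W) ∈ surfaceComponents W N ν → regular W D →
      AlgebraicGeometry.IsNoetherian (menuCentre D).subscheme ∧ Scheme.IsRegular (menuCentre D).subscheme ∧ Scheme.IsExcellent (menuCentre D).subscheme) :
    BadComponentsRegular regular badGatedOfRecord N ν := by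
  refine badComponentsRegular_of_snc regular badGatedOfRecord fun W hW E D hD hr hM => ?_
  obtain ⟨hN, hreg, hexc⟩ := hregular W hW D hD hr
  have hdim := topologicalKrullDim_menuCentre_subscheme_of_mem_surfaceComponents hD
  have hℓ := ((badGatedOfRecord_pos_iff E D).mp hM).1
  by_contra hns
  have := (surfaceSncLength_pos_iff' hF E D (componentsIn.isIrreducible hD.1) hreg hexc hdim).mpr hns
  omega

/-- **o1's `hcure` OBLIGATION DISCHARGED FOR THE READINGS OF RECORD** (composition of `cureStepOfRecord_regular_subset` with the previous theorem): behind the ℓ-gate,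
on a surface component with `D̃` Noetherian regular excellent, every centre the cure of record proposes is a regular subscheme supported in `X(ν)`. [folklore] -/
theorem cureStepOfRecord_regular_subset_of_stacks0BIC (hF : Stacks0BIC_embeddedResolutionCurvesInSurfaces_locus.{u}) (regular : SurfaceRegularity.{u})
    (hregular : ∀ (W : Scheme.{u}) (_ : IsLocallyNoetherian W) (D : Closeds W), (D : Set W) ∈ surfaceComponents W N ν → regular W D →
      AlgebraicGeometry.IsNoetherian (menuCentre D).subscheme ∧ Scheme.IsRegular (menuCentre D).subscheme ∧ Scheme.IsExcellent (menuCentre D).subscheme) :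
    ∀ (W : Scheme.{u}) (hW : IsLocallyNoetherian W) (L : Labelling W) (P : Option (Pending W)) (E : Boundary W) (D : Closeds W) (C : W.IdealSheafData),
      (D : Set W) ∈ surfaceComponents W N ν → regular W D → 0 < badGatedOfRecord W E D → cureStepOfRecord W hW N ν L P E D C →
        Scheme.IsRegular C.subscheme ∧ (C.support : Set W) ⊆ Scheme.hsStratum W N ν :=
  cureStepOfRecord_regular_subset (badComponentsRegular_badGatedOfRecord_of_stacks0BIC hF regular hregular)

/-- **THE CAPSTONE IN (PROGRESS) SHAPE** (`…SigmaMenuTiersWF`: a rank `μ` valued in a well-founded order, here `ℕ ×ₗ ℕ`): the surface rank `toLex (ℓ, M)` strictly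
decreases at every step of the (P1*) prep oracle of record (hypotheses of `lex_surfaceSncLength_badOfRecord_next_lt_of_ofRecord`). [folklore] -/
theorem toLex_surfaceSncLength_badOfRecord_next_lt_of_ofRecord [AlgebraicGeometry.IsNoetherian (menuCentre D).subscheme] {regular : SurfaceRegularity.{u}}
    {phaseS : SurfacePrep.{u}} (h : SurfacePrep.ofRecord regular phaseS badGatedOfRecord cureStepOfRecord pointStepOfRecord W hW N ν L P E D C) (hr : regular W D)
    (hDirr : IsIrreducible (D : Set W)) (hreg : Scheme.IsRegular (menuCentre D).subscheme) (hdim : topologicalKrullDim ↥(menuCentre D).subscheme ≤ 2)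
    (hgate : surfaceSncLength E D = 0 → IsStrictNormalCrossingsDivisor (menuCentre D).subscheme (surfaceTraceSet E D)) (hE : ∀ B ∈ E, IsLocallyPrincipal B)
    (hcoin : E.Coincides C) :
    toLex (surfaceSncLength (E.next C) (surfaceNext (blowup.π C) C D), badOfRecord (blowup C) (E.next C) (surfaceNext (blowup.π C) C D)) <
      toLex (surfaceSncLength E D, badOfRecord W E D) :=
  lex_surfaceSncLength_badOfRecord_next_lt_of_ofRecord h hr hDirr hreg hdim hgate hE hcoin

/-- **THE CAPSTONE IN (PROGRESS) SHAPE ON A SURFACE COMPONENT OF `X(ν)`, ℓ-GATE READ THROUGH F-75c**: binders of o1's oracle laws (`D ∈ surfaceComponents W N ν`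
supplies irreducibility and `dim D̃ = 2`). [folklore] -/
theorem toLex_surfaceSncLength_badOfRecord_next_lt_of_ofRecord_of_stacks0BIC (hF : Stacks0BIC_embeddedResolutionCurvesInSurfaces_locus.{u})
    [AlgebraicGeometry.IsNoetherian (menuCentre D).subscheme] {regular : SurfaceRegularity.{u}} {phaseS : SurfacePrep.{u}} (hD : (D : Set W) ∈ surfaceComponents W N ν)
    (h : SurfacePrep.ofRecord regular phaseS badGatedOfRecord cureStepOfRecord pointStepOfRecord W hW N ν L P E D C) (hr : regular W D)
    (hreg : Scheme.IsRegular (menuCentre D).subscheme) (hexc : Scheme.IsExcellent (menuCentre D).subscheme) (hE : ∀ B ∈ E, IsLocallyPrincipal B)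
    (hcoin : E.Coincides C) :
    toLex (surfaceSncLength (E.next C) (surfaceNext (blowup.π C) C D), badOfRecord (blowup C) (E.next C) (surfaceNext (blowup.π C) C D)) <
      toLex (surfaceSncLength E D, badOfRecord W E D) :=
  lex_surfaceSncLength_badOfRecord_next_lt_of_ofRecord_of_stacks0BIC hF h hr (componentsIn.isIrreducible hD.1) hreg hexc
    (topologicalKrullDim_menuCentre_subscheme_of_mem_surfaceComponents hD) hE hcoin

end GatedRecord

end Summit.ResolutionOfSingularities.ResolutionOfSingularities.Theorems.SigmaMaxModificationsCorridor3.Sigma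

end
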